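import Summits.CriticalPhenomena.PercolationContinuityZ3.Theorems.Transplant.FKConnectivityAllQPat3CornerGluing
import Summits.CriticalPhenomena.PercolationContinuityZ3.Theorems.Transplant.FKConnectivityAllQPat3GenDict
import HarnessLib

/-!
# Connectivity correlation inequalities for `φ_{w,q}`, every `q > 0` — the CORNER configuration in the product-cone machinery
# (Stage S3, part 2): census g32's type-II law as a kernel statement from data

Definitions + theorems file (`--supports stmt-CriticalPhenomena-4575`), census lane `prim-bschramm-census` (gen 36) of the post-continuity programme (LANE 2 bschramm, FK sub-lane);
builds on p205010 (kernel theorem, internal audit signed; external expert review pending).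
No named facts, no sorries; standard axioms.  The two-piece CORNER gluing (`…Pat3CornerGluing`) is fed to the three-piece
symmetrised product-cone lemma `FK.cone3_level_nonneg_sym` with an EMPTY third piece (`FK.apExp_empty`: its level is the constant
`2|V|`; its pattern is ignored by `FK.joinC3`/`FK.corrC3`; its generator is the all-ones table `FK.one2`, levelwise nonnegative):
`FK.hdec_corner`, `FK.Prod2G` (+`toProd3`, `ok`), **`FK.corner_level_nonneg_of_symCertG`** (validity from `IsTTSP`) and
**`FK.corner_level_nonneg_of_symCert`** (validity as hypotheses — the form an induction over cut types consumes) — for two two-terminal series–parallel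
pieces `Q₁ ∋ s`, `Q₂ ∋ t` in parallel between `u ≠ v`, a target `T` on `(u, s, t)` and a checked two-generator certificate,
`0 ≤ D · lev2 (Q₁ ∪ Q₂) u s t T λ` at every level (the placement {corner, inner, inner} of THEOREM SP; data files follow the
THETA/RING recipe with `joinC3`/`corrC3`).
[cite: AyyerLinussonRavichandran2025, §7 eq. (13)–(15) (p. 22)] [cite: Grimmett2006, §3.8 (pp. 61–62)]
-/

noncomputable section

namespace Summit.CriticalPhenomena.PercolationContinuityZ3.Theorems

namespace FK

open SimpleGraph Literature.Probability.LatticeModels Literature.Probability.Percolation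

/-! ### The CORNER configuration as a three-piece gluing with an empty third piece; THEOREM SP for {corner, inner, inner} -/

/-- The all-ones one-level table (the generator carried by the empty third piece). [folklore] -/
def one2 : ℕ → Pat3 → Pat3 → ℤ
  | 0, _, _ => 1
  | _ + 1, _, _ => 0

/-- CORNER join read as a three-piece join law that ignores the (empty) third piece. [folklore] -/
def joinC3 (P1 P2 _P3 : Pat3) : Pat3 := joinC P1 P2

/-- CORNER correction read as a three-piece correction law that ignores the (empty) third piece. [folklore] -/
def corrC3 (P1 P2 _P3 : Pat3) : ℕ := corrC P1 P2

/-- The CORNER correction is at most `2`. [folklore] -/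
theorem corrC3_le_two : ∀ P1 P2 P3 : Pat3, corrC3 P1 P2 P3 ≤ 2 :=
  fun P1 P2 _ => (corrC_le_one P1 P2).trans (by norm_num)

/-- A two-generator certificate product over the dictionary (the third generator is `FK.one2` on the empty piece). [folklore] -/
structure Prod2G where
  /-- numerator of the multiplier -/
  lam : ℕ
  /-- level shift -/
  shift : ℕ
  /-- generator on the first piece -/
  g1 : Gen
  /-- generator on the second piece -/
  g2 : Gen

/-- The raw three-generator product of a two-generator product. [folklore] -/
def Prod2G.toProd3 (p : Prod2G) : Prod3 := ⟨p.lam, p.shift, p.g1.tab, p.g2.tab, one2⟩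

/-- Both generators pass their side conditions. [folklore] -/
def Prod2G.ok (p : Prod2G) : Bool := p.g1.ok && p.g2.ok

section CornerCone

open scoped Classical

variable {V : Type*} [Fintype V]

/-- The antipodal exponent of the empty network is `2|V|`. [folklore] -/
theorem apExp_empty : apExp (∅ : Finset (Sym2 V)) ∅ = 2 * Fintype.card V := by
  unfold apExp
  rw [Finset.sdiff_self, Finset.coe_empty, clusterCount_empty_card]
  ring

omit [Fintype V] in
/-- The dummy generator is levelwise nonnegative on any piece. [folklore] -/
theorem lev2_one2_nonneg (E : Finset (Sym2 V)) (x y s : V) (μ : ℕ) : 0 ≤ lev2 E x y s one2 μ :=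
  lev2_nonneg_of_mval2 (fun _ hw => mval2_nonneg_of_coef (fun c P Q => by rcases c with _ | c <;> simp [one2]) hw) μ

variable {E₁ E₂ : Finset (Sym2 V)} {V₁ V₂ : Set V} {u v : V}

/-- The CORNER decomposition in the three-piece shape consumed by `FK.cone3_level_nonneg_sym` (empty third piece, offset
`4|V|`). [folklore] -/
theorem hdec_corner (hd : Disjoint E₁ E₂) (h₁ : ∀ e ∈ (↑E₁ : Set (Sym2 V)), ∀ z ∈ e, z ∈ V₁)
    (h₂ : ∀ e ∈ (↑E₂ : Set (Sym2 V)), ∀ z ∈ e, z ∈ V₂) (h12 : V₁ ∩ V₂ ⊆ ({u, v} : Set V)) (huv : u ≠ v)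
    {s t : V} (hs2 : s ∉ V₂) (ht1 : t ∉ V₁) (hsu : s ≠ u) (hsv : s ≠ v) (htu : t ≠ u) (htv : t ≠ v) (hst : s ≠ t)
    (w : ℕ → ℝ) (tab : Pat3 → Pat3 → ℤ) :
    tval (fun n => w (n + 4 * Fintype.card V)) (E₁ ∪ E₂) u s t tab =
      ∑ γ₁ ∈ E₁.powerset, ∑ γ₂ ∈ E₂.powerset, ∑ γ₃ ∈ (∅ : Finset (Sym2 V)).powerset,
        w (apExp E₁ γ₁ + apExp E₂ γ₂ + apExp ∅ γ₃ + corrC3 (pat3 γ₁ u v s) (pat3 γ₂ u v t) (pat3 γ₃ u v s) +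
            corrC3 (pat3 (E₁ \ γ₁) u v s) (pat3 (E₂ \ γ₂) u v t) (pat3 (∅ \ γ₃) u v s)) *
          (tab (joinC3 (pat3 γ₁ u v s) (pat3 γ₂ u v t) (pat3 γ₃ u v s))
            (joinC3 (pat3 (E₁ \ γ₁) u v s) (pat3 (E₂ \ γ₂) u v t) (pat3 (∅ \ γ₃) u v s)) : ℝ) := by
  have h2 := tval_union2_corner hd h₁ h₂ h12 huv hs2 ht1 hsu hsv htu htv hst (fun m => w (m + 2 * Fintype.card V)) tab
  beta_reduce at h2
  have e : (fun n => w (n + 4 * Fintype.card V)) = fun n => w (n + 2 * Fintype.card V + 2 * Fintype.card V) := by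
    funext n
    congr 1
    ring
  rw [e, h2]
  refine Finset.sum_congr rfl fun γ₁ _ => Finset.sum_congr rfl fun γ₂ _ => ?_
  simp only [Finset.powerset_empty, Finset.sum_singleton, apExp_empty, joinC3, corrC3]
  congr 2
  ring

/-- **THEOREM SP for the CORNER placement from data** (census g32's type-II law as a kernel statement): two two-terminal
series–parallel pieces `Q₁ ∋ s`, `Q₂ ∋ t` glued in parallel between `u ≠ v` (edge-disjoint, vertex supports meeting inside
`{u, v}`, marks inner), a target `T` on the marks `(u, s, t)` (one mark AT the corner), a two-generator product list over the
dictionary passing `Prod2G.ok`, and the symmetrised certificate family for the embedded three-piece products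
(`FK.symCert_of_pairs` with `joinC3`/`corrC3`) ⇒ `0 ≤ D · lev2 (Q₁ ∪ Q₂) u s t T λ` at every level.
[cite: AyyerLinussonRavichandran2025, §7 (p. 22)] -/
theorem corner_level_nonneg_of_symCertG {s t : V} (hd : Disjoint E₁ E₂) (h₁ : ∀ e ∈ (↑E₁ : Set (Sym2 V)), ∀ z ∈ e, z ∈ V₁)
    (h₂ : ∀ e ∈ (↑E₂ : Set (Sym2 V)), ∀ z ∈ e, z ∈ V₂) (h12 : V₁ ∩ V₂ ⊆ ({u, v} : Set V)) (huv : u ≠ v)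
    (hs2 : s ∉ V₂) (ht1 : t ∉ V₁) (hsu : s ≠ u) (hsv : s ≠ v) (htu : t ≠ u) (htv : t ≠ v) (hst : s ≠ t)
    (h1sp : IsTTSP E₁ u v) (h2sp : IsTTSP E₂ u v) (hs1 : ∃ e ∈ E₁, s ∈ e) (ht2 : ∃ e ∈ E₂, t ∈ e)
    (T : ℕ → Pat3 → Pat3 → ℤ) (D : ℕ) (prods : List Prod2G) (hok : (prods.all Prod2G.ok) = true)
    (hcert : ∀ d : ℕ, ∀ P1 Q1 P2 Q2 P3 Q3 : Pat3,
      8 * ∑ j : Fin (prods.map Prod2G.toProd3).length,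
          (((prods.map Prod2G.toProd3).get j).lam : ℤ) * ((prods.map Prod2G.toProd3).get j).tensor d P1 Q1 P2 Q2 P3 Q3 ≤
        D * target3Sym joinC3 corrC3 T d P1 Q1 P2 Q2 P3 Q3)
    (lam : ℕ) : 0 ≤ (D : ℤ) * lev2 (E₁ ∪ E₂) u s t T lam := by
  refine cone3_level_nonneg_sym (EK := E₁) (E₁ := E₂) (E₂ := (∅ : Finset (Sym2 V))) (uK := u) (vK := v) (mK := s)
    (u₁ := u) (v₁ := v) (m₁ := t) (u₂ := u) (v₂ := v) (m₂ := s) joinC3 corrC3 (4 * Fintype.card V)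
    (fun w tab => hdec_corner hd h₁ h₂ h12 huv hs2 ht1 hsu hsv htu htv hst w tab) T D Finset.univ
    (fun j => (prods.map Prod2G.toProd3).get j) hcert (fun j _ μ => ?_) lam
  have hp : (prods.map Prod2G.toProd3).get j ∈ prods.map Prod2G.toProd3 := List.get_mem _ j
  rw [List.mem_map] at hp
  obtain ⟨g, hg, hgj⟩ := hp
  rw [← hgj]
  rw [List.all_eq_true] at hok
  have h := hok g hg
  simp only [Prod2G.ok, Bool.and_eq_true] at h
  exact ⟨Gen.lev2_nonneg h1sp hs1 hsu hsv _ h.1 μ, Gen.lev2_nonneg h2sp ht2 htu htv _ h.2 μ, lev2_one2_nonneg _ u v s μ⟩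

/-- **The CORNER product-cone lemma with validity HYPOTHESES** (the form THEOREM 3C's induction consumes: the generators'
levelwise nonnegativity on the two sides is assumed, not derived from `IsTTSP`; the empty piece carries any table with
nonnegative `(sep, sep)` entries, e.g. `FK.one2`). [cite: AyyerLinussonRavichandran2025, §7 (p. 22)] -/
theorem corner_level_nonneg_of_symCert {s t : V} (hd : Disjoint E₁ E₂) (h₁ : ∀ e ∈ (↑E₁ : Set (Sym2 V)), ∀ z ∈ e, z ∈ V₁)
    (h₂ : ∀ e ∈ (↑E₂ : Set (Sym2 V)), ∀ z ∈ e, z ∈ V₂) (h12 : V₁ ∩ V₂ ⊆ ({u, v} : Set V)) (huv : u ≠ v)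
    (hs2 : s ∉ V₂) (ht1 : t ∉ V₁) (hsu : s ≠ u) (hsv : s ≠ v) (htu : t ≠ u) (htv : t ≠ v) (hst : s ≠ t)
    (T : ℕ → Pat3 → Pat3 → ℤ) (D : ℕ) {ι : Type*} (J : Finset ι) (prod : ι → Prod3)
    (hcert : ∀ d : ℕ, ∀ P1 Q1 P2 Q2 P3 Q3 : Pat3,
      8 * ∑ j ∈ J, ((prod j).lam : ℤ) * (prod j).tensor d P1 Q1 P2 Q2 P3 Q3 ≤ D * target3Sym joinC3 corrC3 T d P1 Q1 P2 Q2 P3 Q3)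
    (hval : ∀ j ∈ J, ∀ μ : ℕ, 0 ≤ lev2 E₁ u v s (prod j).gK μ ∧ 0 ≤ lev2 E₂ u v t (prod j).g1 μ ∧
      0 ≤ lev2 (∅ : Finset (Sym2 V)) u v s (prod j).g2 μ)
    (lam : ℕ) : 0 ≤ (D : ℤ) * lev2 (E₁ ∪ E₂) u s t T lam :=
  cone3_level_nonneg_sym (EK := E₁) (E₁ := E₂) (E₂ := (∅ : Finset (Sym2 V))) (uK := u) (vK := v) (mK := s)
    (u₁ := u) (v₁ := v) (m₁ := t) (u₂ := u) (v₂ := v) (m₂ := s) joinC3 corrC3 (4 * Fintype.card V)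
    (fun w tab => hdec_corner hd h₁ h₂ h12 huv hs2 ht1 hsu hsv htu htv hst w tab) T D J prod hcert hval lam

end CornerCone

end FK

end Summit.CriticalPhenomena.PercolationContinuityZ3.Theorems

end
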